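import Literature.MathematicalPhysics.QuantumFieldTheory.Balaban1983to89.B9Ineq3137From149
import Literature.MathematicalPhysics.QuantumFieldTheory.Balaban1983to89.B9Eq315QTower
import Literature.MathematicalPhysics.QuantumFieldTheory.Balaban1983to89.B9Eq315QTorusOnto

/-!
# `Balaban1983to89.B7Eq141TorusImagesCount` — T. Bałaban, *Averaging operations for lattice gauge theories*, Commun. Math. Phys. **98** (1985) 17–51
[Balaban1985Averaging], (1)–(2) p. 17 (the lattices and their blocks; «Ω^{(j)} may be replaced by any other lattice», p. 19), p. 24 (locality of the
`k`-fold average in `Bᵏ(c₋) ∪ Bᵏ(c₊)`), (141)–(142) p. 39 (the column of `Q″_k`): **PERIOD IMAGES OF A TORUS BOND IN THE DOUBLED FUNDAMENTAL DOMAIN AND THE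
COARSE-COLUMN COUNT** — on `[0, 2P)` the periodic extension of a one-bond torus direction is the sum of its `2^d` single-bond images; every box
`Bᵏ(c₋) ∪ Bᵏ(c₊)` of a unit-torus bond lies in `[0, 2P)`; the count of images of the fine bond `b` in the box of the coarse bond `c` sums (with the weight `L^{−kd}` of (141)) to `≤ 2^d·2d·L^{−kd}` over `c` — the torus form of the count dual to (141)/(142) (`B9Ineq3137From149.sum_kerQdd_transpose_le`); bookkeeping for the sequel
`B11Eq44CKernelColumnTower` (Prop. 5 (157) read on the torus letter `C_k` of [Balaban1985Variational] (44))

statement-level skeleton of published theorems with citation tags; proofs where landed; nothing here is a claim about the Yang–Mills mass gap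

PDF held: `paper:balaban1985-cmp98-averaging` (journal page = PDF page + 16); p. 17, p. 24, p. 39 through the verbatim quotations of `B9Eq315QTorus`,
`B7Prop1Local` (p. 24: *«this definition is local in the sense that Ū^k_c, c ⊂ Ω^{(k)}, depends only on the bond variables U_b for b ⊂ B^k(c₋) ∪ B^k(c₊)»*)
and `B7Prop5GeneralOperators` ((141) *«(Q″_kA)_c = Σ_{b⊂B^k(c₋)∪B^k(c₊)} η^dA_b»*).

WHAT IS PROVED (sorry-free; NO definition — the shift set is written `Fintype.piFinset fun _ => {0, 1}` throughout; torus arithmetic on the tree's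
dictionary `perSite`∕`liftSite`∕`periodVec`∕`towerP`).
* §1 `mem_shifts`, `card_shifts` (`= 2^d`), `periodVec_injective`, **`single_perSite_eq_sum_bump`** — for `x′ ∈ [0, 2P)`:
  `(X·δ_{(x,μ)})(x′ mod P, μ′) = Σ_{t∈{0,1}^d} (X·δ_{(x̃+Pt, μ)})(x′, μ′)` (`x̃` the representative of `x`).
* §2 `inBox_tower_bounds` (the box of a unit-torus bond, read at the representative `Lᵏỹ`, lies in `[0, 2Lᵏm)`), `liftBond_injective`,
  **`sum_images_kerQdd_le`** (`Σ_{c∈T_m} Σ_{t∈{0,1}^d} kerQdd(c̃; x̃ + Pt, μ) ≤ 2^d·2d·L^{−kd}` — the image count, weighted as (141)).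
HONEST SCOPE.  Arithmetic only; NOT summit progress (cell pub-balaban: NE9 NOT PRINTED ∕ NOT PROVED; spine PROVED 0∕9; rung (B)+1 on a finite T⁴ — NOT
infinite volume, NOT mass gap, NOT Clay).  Filed by the NE9 crux-team leaf seat `b2b-balaban-t4-ne9-formalise-leaf-01` (gen 97); NEW file; imports
`B9Ineq3137From149`, `B9Eq315QTower`, `B9Eq315QTorusOnto`; nothing modified.
-/

noncomputable section

open scoped BigOperators
open Finset Metric Set

namespace Literature.MathematicalPhysics.QuantumFieldTheory.Balaban1983to89.B7Eq141TorusImagesCount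

open B7Prop1Local (InBox AgreeOn loK bondHiK)
open B7Prop5Flat (bump BondIn)
open B7Prop5GeneralOperators (kerQdd kerQdd_of_bondIn kerQdd_of_not_bondIn kerQdd_nonneg)
open B9Eq315QTorus (perSite perCfg perCfg_apply)
open B9Eq315QTorusOnto (liftSite periodVec perSite_add_periodVec liftSite_perSite_add perSite_liftSite)
open B9Eq315QTower (towerP towerP_apply)
open B9Ineq3137From149 (sum_kerQdd_transpose_le)
open B9SectCLatticeCarrier (Bond)
open B4Sect5Torus (TSite)

-- `Site` alone would resolve to the torus sites of `Setup.lean`; re-export the `ℤ^d` sites of `B7Prop1Explicit`.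
export B7Prop1Explicit (Site)

variable {d : ℕ}

/-! ## §1 The periodic images of a torus bond in the doubled fundamental domain -/

section Shifts

/-- Membership in the shift set `{0,1}^d ⊂ ℤ^d` — the multi-indices `t` of the period translates `x̃ + (P_it_i)_i` of a representative `x̃ ∈ [0, P)`
that can lie in the doubled domain `[0, 2P)`, where every box `Bᵏ(c₋) ∪ Bᵏ(c₊)` of a unit-torus bond sits. [cite: Balaban1985Averaging, (1) p.17] -/
theorem mem_shifts {t : Site d} : t ∈ (Fintype.piFinset fun _ : Fin d => ({0, 1} : Finset ℤ)) ↔ ∀ i, t i = 0 ∨ t i = 1 := by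
  simp [Fintype.mem_piFinset]

/-- `#{0, 1}^d = 2^d`: the number of period images of a representative in the doubled fundamental domain. [cite: Balaban1985Averaging, (1) p.17] -/
theorem card_shifts (d : ℕ) : (Fintype.piFinset fun _ : Fin d => ({0, 1} : Finset ℤ)).card = 2 ^ d := by
  rw [Fintype.card_piFinset, Finset.prod_const, Finset.card_univ, Fintype.card_fin]
  norm_num

variable {𝔸 : Type*} [NormedRing 𝔸] (P : Fin d → ℕ) [∀ i, NeZero (P i)]

/-- Period vectors are injective in the multi-index (`P_i ≠ 0`). [cite: Balaban1985Averaging, (1) p.17] -/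
theorem periodVec_injective : Function.Injective (periodVec P) := by
  intro t t' h
  funext i
  have hi := congrFun h i
  simp only [periodVec] at hi
  have hP : (P i : ℤ) ≠ 0 := by exact_mod_cast NeZero.ne (P i)
  exact mul_left_cancel₀ hP hi

/-- **A torus direction supported at one bond, extended periodically, IS — on the doubled fundamental domain `[0, 2P)` — the finite sum of
its `2^d` single-bond images** `x̃ + (P_it_i)`, `t ∈ {0,1}^d` (`x̃` the representative in `[0, P)`).
[cite: Balaban1985Averaging, (1) p.17, (137)–(138) p.39] -/
theorem single_perSite_eq_sum_bump (xb : TSite d P) (μ : Fin d) (X : 𝔸) (x' : Site d) (μ' : Fin d)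
    (hx0 : ∀ i, 0 ≤ x' i) (hx2 : ∀ i, x' i < 2 * (P i : ℤ)) :
    (Pi.single (xb, μ) X : Bond d P → 𝔸) (perSite P x', μ') =
      ∑ t ∈ (Fintype.piFinset fun _ : Fin d => ({0, 1} : Finset ℤ)), bump (liftSite xb + periodVec P t) μ X x' μ' := by
  classical
  by_cases hμ : μ' = μ
  · subst hμ
    by_cases hx : perSite P x' = xb
    · rw [hx, Pi.single_eq_same]
      -- the multi-index of `x'`
      set t₀ : Site d := fun i => x' i / (P i : ℤ) with ht₀
      have ht₀mem : t₀ ∈ (Fintype.piFinset fun _ : Fin d => ({0, 1} : Finset ℤ)) := by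
        rw [mem_shifts]
        intro i
        have hP : (0 : ℤ) < (P i : ℤ) := by exact_mod_cast Nat.pos_of_ne_zero (NeZero.ne (P i))
        have h0 : 0 ≤ x' i / (P i : ℤ) := Int.ediv_nonneg (hx0 i) hP.le
        have h2 : x' i / (P i : ℤ) < 2 := Int.ediv_lt_of_lt_mul hP (by linarith [hx2 i])
        simp only [ht₀]
        omega
      have hx' : x' = liftSite xb + periodVec P t₀ := by
        have h := liftSite_perSite_add P x'
        rw [hx] at h
        exact h.symm
      rw [Finset.sum_eq_single t₀]
      · simp [bump, hx']
      · intro t _ ht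
        have hne : x' ≠ liftSite xb + periodVec P t := by
          intro h
          rw [hx'] at h
          exact ht (periodVec_injective P (add_left_cancel h)).symm
        simp [bump, hne]
      · exact fun h => (h ht₀mem).elim
    · have hne : ((perSite P x', μ') : Bond d P) ≠ (xb, μ') := fun h => hx (Prod.mk.inj h).1
      rw [Pi.single_eq_of_ne hne]
      refine (Finset.sum_eq_zero fun t _ => ?_).symm
      have hne' : x' ≠ liftSite xb + periodVec P t := by
        intro h
        apply hx
        rw [h, perSite_add_periodVec, perSite_liftSite]
      simp [bump, hne']
  · have hne : ((perSite P x', μ') : Bond d P) ≠ (xb, μ) := fun h => hμ (Prod.mk.inj h).2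
    rw [Pi.single_eq_of_ne hne]
    refine (Finset.sum_eq_zero fun t _ => ?_).symm
    simp [bump, hμ]

end Shifts

/-! ## §2 The boxes of the unit torus sit in the doubled fundamental domain; the coarse-column count -/

section Count

variable (L : ℕ) (m : Fin d → ℕ) [∀ i, NeZero (m i)] (k : ℕ)

/-- Every point of the box `Bᵏ(c₋) ∪ Bᵏ(c₊)` of a unit-torus bond `c = (y, κ)` (read at the representative `Lᵏ·ỹ`, `ỹ ∈ [0, m)`) lies in the
doubled fundamental domain `[0, 2Lᵏm)` of the fine torus. [cite: Balaban1985Averaging, p.24 (after (43)), (1)–(2) p.17] -/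
theorem inBox_tower_bounds (hL : 1 ≤ L) (y : TSite d m) (κ : Fin d) {x' : Site d}
    (hx : InBox (loK L k (liftSite y)) (bondHiK L k (liftSite y) κ) x') (i : Fin d) :
    0 ≤ x' i ∧ x' i < 2 * (towerP L m k i : ℤ) := by
  have h1 := (hx i).1
  have h2 := (hx i).2
  simp only [loK, liftSite] at h1
  simp only [bondHiK, liftSite] at h2
  have hy0 : (0 : ℤ) ≤ ((y i : ℕ) : ℤ) := by positivity
  have hy1 : ((y i : ℕ) : ℤ) + 1 ≤ (m i : ℤ) := by
    have := (y i).isLt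
    omega
  have hLk : (1 : ℤ) ≤ (L : ℤ) ^ k := by exact_mod_cast Nat.one_le_pow k L hL
  have hLk0 : (0 : ℤ) ≤ (L : ℤ) ^ k := by positivity
  have hprod : (L : ℤ) ^ k * (((y i : ℕ) : ℤ) + 1) ≤ (L : ℤ) ^ k * (m i : ℤ) := mul_le_mul_of_nonneg_left hy1 hLk0
  have hm1 : (1 : ℤ) ≤ (m i : ℤ) := by exact_mod_cast Nat.pos_of_ne_zero (NeZero.ne (m i))
  have hLm : (L : ℤ) ^ k ≤ (L : ℤ) ^ k * (m i : ℤ) := le_mul_of_one_le_right hLk0 hm1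
  rw [towerP_apply]
  push_cast
  refine ⟨by nlinarith, ?_⟩
  split_ifs at h2 <;> nlinarith

/-- Lifting coarse torus bonds to `ℤ^d` is injective. [cite: Balaban1985Averaging, (1) p.17] -/
theorem liftBond_injective :
    Function.Injective (fun c : Bond d m => ((liftSite c.1, c.2) : Site d × Fin d)) := by
  intro c c' h
  obtain ⟨h1, h2⟩ := Prod.mk.inj h
  refine Prod.ext ?_ h2
  have := congrArg (perSite m) h1
  rwa [perSite_liftSite, perSite_liftSite] at this

/-- **THE COARSE-COLUMN COUNT: `Σ_c Σ_{t∈{0,1}^d} kerQdd(c̃; x̃ + Pt, μ) ≤ 2^d·2d·L^{−kd}`** — every period image of the fine torus bond `b = (x, μ)` lies in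
at most `2d` boxes `Bᵏ(c₋) ∪ Bᵏ(c₊)` (`B9Ineq3137From149.sum_kerQdd_transpose_le`, the count dual to (141)/(142)), and there are `2^d` images; `kerQdd` carries
the weight `L^{−kd}` of (141). [cite: Balaban1985Averaging, (141)–(142) p.39] -/
theorem sum_images_kerQdd_le (hL : 1 ≤ L) (b : Bond d (towerP L m k)) :
    ∑ c : Bond d m, ∑ t ∈ (Fintype.piFinset fun _ : Fin d => ({0, 1} : Finset ℤ)),
        kerQdd L k (liftSite c.1) c.2 (liftSite b.1 + periodVec (towerP L m k) t) b.2 ≤ 2 ^ d * (2 * d) * (((L : ℝ) ^ k) ^ d)⁻¹ := by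
  classical
  rw [Finset.sum_comm]
  calc ∑ t ∈ (Fintype.piFinset fun _ : Fin d => ({0, 1} : Finset ℤ)), ∑ c : Bond d m,
          kerQdd L k (liftSite c.1) c.2 (liftSite b.1 + periodVec (towerP L m k) t) b.2
      ≤ ∑ _t ∈ (Fintype.piFinset fun _ : Fin d => ({0, 1} : Finset ℤ)), 2 * (d : ℝ) * (((L : ℝ) ^ k) ^ d)⁻¹ :=
        Finset.sum_le_sum fun t _ => by
          have h := sum_kerQdd_transpose_le hL k (Finset.univ.image fun c : Bond d m => ((liftSite c.1, c.2) : Site d × Fin d))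
            (liftSite b.1 + periodVec (towerP L m k) t) b.2
          rwa [Finset.sum_image fun c _ c' _ h => liftBond_injective m h] at h
    _ = 2 ^ d * (2 * d) * (((L : ℝ) ^ k) ^ d)⁻¹ := by rw [Finset.sum_const, card_shifts, nsmul_eq_mul]; push_cast; ring

end Count

end Literature.MathematicalPhysics.QuantumFieldTheory.Balaban1983to89.B7Eq141TorusImagesCount

end
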